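import Summits.QuantumFields.BalabanUV.T4Continuum.Support.SkeletonLattice

/-!
# T⁴ programme, node NE3 — the kinematic refinement lemma, leaf R1a+R1b (row NE3-S4c), file 2:
# THE 2-SKELETON FILLING OF THE REFINED LATTICE — every fine plaquette of a coarse 2-cell EQUALS the `L²`-th root of the
# cell's boundary holonomy, every coarse bond's chain product EQUALS its 1-skeleton datum (group level, closed form)

Cell `pub-balaban`, NE3 (node U1b) formalisation swarm, unit `b2b-balaban-t4-ne3-formalise-leaf-01` (LEAF PROVER 01),
row **S4c** of `t4/formal/NE3/LEAVES.md` (leaf R1a+R1b of the OWNER skeleton `t4/b2b-balaban-t4-ne3-p1/SKELETON-NE3-P1.md`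
v1.1 §3; companion rows: S4a∕S4a′ the exact chain-end correction R2, S4b the abelian sanity case, S4d the 3-∕4-cell
filling, S4e the loop-log prediction, R0 the glue to `MinimalActionRefine.SmoothRefine`).

## The mechanism (skeleton v1.1 §2 ¶3, leaf R1), and what is proved here

The kinematic lemma asks, for a regular coarse configuration `U`, for a regular FINE configuration whose one-step
Bałaban average (42) is (after the exact correction R2) `U`.  Its first two storeys are built here in CLOSED FORM, for an
arbitrary group `G`, from two data on the coarse lattice: the 1-SKELETON DATUM `T : Site d → Fin d → G` (the value of the
LAST fine bond of each coarse bond's chain, all other chain bonds being `1`; the pre-compensated choice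
`T = exp(−X₀)·U` of leaf R1a is a separate matter — every statement below holds for any `T`) and a ROOT DATUM
`h : Site d → Fin d → Fin d → G` with `h(z; κ, ν)^{L²} = T(∂p_{κν}(z))` (`= hol T z (plaqWord κ ν)`, the plaquette holonomy
of `T` read as a configuration on the coarse lattice).  THE FILLING (`cellVal` ∕ `skelFill`): in the coarse 2-cell
`(z; κ < ν)` with fine coordinates `(s, t) ∈ [0, L]²`, the bond in direction `κ` at `(s, t)` is `h^{−t} · [T(z, κ) if s = L−1]`
and the bond in direction `ν` at `(s, t)` is `[h^{sL} · T(z, ν) if t = L−1]`, else `1` — frames trivial in the bulk, the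
curvature carried by the rows, the coarse data and the compensating powers `h^{sL}` by the last column ∕ top row.  THEN:
* **`hol_plaq_eq`**: EVERY one of the `L²` unit plaquettes of the cell has holonomy EXACTLY `h(z; κ, ν)` (four cases:
  bulk `h^{−t}h^{t+1}`; last column — `T(z, κ)` cancels; top row — `h^{−(L−1)} h^{(s+1)L} h^{−sL}`; far corner — where
  `h^{L²} = T(∂p)` enters);
* **`hol_seg_eq`**: the chain product of every coarse bond is `W(Γ_c) = T(z, κ)` (so `\bar W(c) = exp(X_c(W))·T(c)` in (42));
* the statements are proved for every configuration `W` that is LAWFUL ON THE 2-SKELETON (`LawfulFill`: agrees with the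
  closed form on the bonds with at most one non-zero transverse offset) — `skelFill` (value `1` inside the cells of
  dimension `≥ 3`) is lawful, and so is any higher-cell extension of it (row S4d), which therefore inherits both theorems;
* transport: values in any subgroup containing the data (`skelFill_mem`: unitarity), `L·P`-periodicity from `P`-periodic
  data (`skelFill_add_period`).
The matrix-level consequences (unitary roots `h = exp(L^{−2} log T(∂p))`, plaquettes within `4·a_T/L²` of `1`, fluxes
`= L^{−2} log T(∂p)`, in-cell covariant flux gradients ZERO and cross-line ones `= L^{−2}×` the coarse covariant flux
gradient of `T`) are file 3 (`SkeletonFillUnitary`).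

Ancestry (none of which has the closed form or the exactness statements): M. Lüscher, Commun. Math. Phys. 85 (1982)
39–48 (cell-by-cell interpolation under a small-plaquette bound); G. 't Hooft, Phys. Lett. B 349 (1995) 491;
Endres–Brower–Detmold–Orginos–Pochinsky, Phys. Rev. D 92 (2015) 114516 §3 («interpolation proceeds from low dimensional to
high dimensional cells»).  The construction is OURS, elementary, manuscript-free.

HONEST FRAMING.  Group-level lattice gauge kinematics; no estimate, no minimiser, no variational problem; no conditional of
the cell (`BetaPertH`, (B), (B^μ)) is used or hidden; nothing bears on infinite volume, a mass gap, or the Clay problem;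
**NE3 is NOT proved** — this is one leaf (R1a+R1b, the 2-skeleton) of the kinematic lemma `SmoothRefine` (ours, unproved:
leaves R1c–e, R2, R0 open), which is itself one hypothesis of the re-cut `MinimalActionRefine.sandwichData_of_smoothRefine`
of NE3's reading (A); it instantiates NO leaf of NE3 on Bałaban's minimisers.  Finite T⁴ rung (B)+1.  ABSOLUTE RULE of
the cell kept: no printed sentence is a hypothesis of any declaration (`LawfulFill` is a parametric SHAPE on
configurations, not a fact); no `sorry`, axioms ⊆ {propext, Classical.choice, Quot.sound}.  PLACEMENT (human rule
2026-08-19): cell work under `Summits/QuantumFields/BalabanUV/`; imports file 1 only; moves nothing.  Records: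
`t4/formal/NE3/LEAVES.md` row S4c, `t4/T4-EST-NE3-P1.md`, skeleton v1.1 of the cell `pub-balaban`.
-/

set_option autoImplicit false

namespace Summit.QuantumFields.BalabanUV.T4Continuum.SkeletonFill

open Literature.MathematicalPhysics.QuantumFieldTheory.Balaban1983to89
open B7Prop1Explicit B7Prop2Explicit B7Prop1Local
open Finset SkeletonLattice

variable {d : ℕ}

/-! ## §1 The filling of the 2-skeleton (any group `G`) -/

section Fill

variable {G : Type*} [Group G]
variable (L : ℕ)

/-- THE CLOSED-FORM BOND VALUES ON THE 2-SKELETON.  Data: the 1-skeleton datum `T` (one group element per coarse bond: the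
value of the LAST fine bond of the coarse bond's chain, all other chain bonds being `1`) and a root datum `h` (one group
element per coarse plaquette `(z; κ < ν)`, meant to satisfy `h^{L²} = T(∂p)`).  For the fine bond in direction `μ` at the
site with coarse coordinate `z` and offsets `q`, whose only (possibly) non-zero transverse offset is in direction `ν`:
* `μ < ν` («horizontal» bond of the cell `(z; μ, ν)` at height `t = q_ν`): `h^{−t} · [T(z, μ) if q_μ = L − 1]`;
* `ν < μ` («vertical» bond of the cell `(z; ν, μ)` in column `s = q_ν`): `[h^{sL} · T(z, μ) if q_μ = L − 1]`, else `1`.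
For `q_ν = 0` both formulas give the 1-skeleton chain `(1, …, 1, T(z, μ))`. [folklore] -/
def cellVal (T : Site d → Fin d → G) (h : Site d → Fin d → Fin d → G) (z q : Site d) (μ ν : Fin d) : G :=
  if μ < ν then ((h z μ ν) ^ (q ν).toNat)⁻¹ * (if q μ = (L : ℤ) - 1 then T z μ else 1)
  else if ν < μ then (if q μ = (L : ℤ) - 1 then (h z ν μ) ^ ((q ν).toNat * L) * T z μ else 1)
  else (if q μ = (L : ℤ) - 1 then T z μ else 1)

/-- THE 2-SKELETON FILLING `skelFill L T h` of the refined lattice `ℤ^d`: the closed form `cellVal` on every fine bond with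
at most one non-zero transverse offset (the bonds of the coarse lines and of the coarse 2-cells), and `1` on the bonds
interior to coarse cells of dimension `≥ 3` (left to the higher-cell filling, which only has to AGREE with this one on the
2-skeleton: `LawfulFill`). [folklore] -/
noncomputable def skelFill (T : Site d → Fin d → G) (h : Site d → Fin d → Fin d → G) (x : Site d) (μ : Fin d) : G :=
  if hne : (tset L x μ).Nonempty then
    (if (tset L x μ).card ≤ 1 then cellVal L T h (cdiv L x) (cmod L x) μ ((tset L x μ).min' hne) else 1)
  else (if cmod L x μ = (L : ℤ) - 1 then T (cdiv L x) μ else 1)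

/-- A fine configuration is LAWFUL ON THE 2-SKELETON (w.r.t. the data `T`, `h`) if on every fine bond with at most one
non-zero transverse offset it takes the closed-form value `cellVal`.  `skelFill` is lawful; so is every extension of it
to the higher cells. [shape] A parametric definition of a proposition on configurations — NOT a fact. [folklore] -/
@[folklore]
def LawfulFill (T : Site d → Fin d → G) (h : Site d → Fin d → Fin d → G) (W : Site d → Fin d → G) : Prop :=
  ∀ (x : Site d) (μ ν : Fin d), (∀ i, i ≠ μ → i ≠ ν → cmod L x i = 0) →
    W x μ = cellVal L T h (cdiv L x) (cmod L x) μ ν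

variable {L}

/-- On a coarse line (all transverse offsets zero) `cellVal` does not depend on the auxiliary direction: it is the chain
value `(1, …, 1, T)`. [folklore] -/
theorem cellVal_of_line (T : Site d → Fin d → G) (h : Site d → Fin d → Fin d → G) {z q : Site d} {μ ν : Fin d}
    (hq : ν ≠ μ → q ν = 0) : cellVal L T h z q μ ν = if q μ = (L : ℤ) - 1 then T z μ else 1 := by
  unfold cellVal
  by_cases h1 : μ < ν
  · simp [h1, hq (ne_of_gt h1)]
  · by_cases h2 : ν < μ
    · simp [h1, h2, hq (ne_of_lt h2)]
    · simp [h1, h2]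

/-- `skelFill` is lawful on the 2-skeleton. [folklore] -/
theorem lawfulFill_skelFill (T : Site d → Fin d → G) (h : Site d → Fin d → Fin d → G) :
    LawfulFill L T h (skelFill L T h) := by
  intro x μ ν h0
  unfold skelFill
  by_cases hne : (tset L x μ).Nonempty
  · have hνμ : ν ≠ μ := by
      rintro rfl
      obtain ⟨i, hi⟩ := hne
      rw [mem_tset] at hi
      exact hi.2 (h0 i hi.1 hi.1)
    have hsub := tset_subset_singleton (L := L) h0
    have heq : tset L x μ = {ν} := Finset.eq_singleton_iff_nonempty_unique_mem.mpr
      ⟨hne, fun i hi => mem_singleton.mp (hsub hi)⟩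
    have hmin : (tset L x μ).min' hne = ν := mem_singleton.mp (heq ▸ min'_mem (tset L x μ) hne)
    rw [dif_pos hne, if_pos (by rw [heq]; simp), hmin]
  · rw [dif_neg hne]
    have hqν : ν ≠ μ → cmod L x ν = 0 := by
      intro hνμ
      by_contra hq
      exact hne ⟨ν, mem_tset.mpr ⟨hνμ, hq⟩⟩
    rw [cellVal_of_line T h hqν]

end Fill

/-! ## §2 The bond values of a lawful configuration on lines and 2-cells -/

section Bonds

variable {G : Type*} [Group G] {L : ℕ} {T : Site d → Fin d → G} {h : Site d → Fin d → Fin d → G}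
  {W : Site d → Fin d → G}

/-- THE GENERIC 2-SKELETON BOND in direction `κ` («horizontal» when `κ < ν`): at `L z + s e_κ + t e_ν`, `s, t < L`,
its value is `h^{−t} · [T(z, κ) if s = L − 1]`. [folklore] -/
theorem val_horizontal (hW : LawfulFill L T h W) {κ ν : Fin d} (hκν : κ < ν) (z : Site d) {s t : ℕ}
    (hs : s < L) (ht : t < L) :
    W ((L : ℤ) • z + off2 κ ν s t) κ
      = ((h z κ ν) ^ t)⁻¹ * (if s = L - 1 then T z κ else 1) := by
  have hL : 1 ≤ L := by omega
  have hne : κ ≠ ν := ne_of_lt hκν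
  rw [hW _ κ ν (fun i hiκ hiν => by rw [cmod_off2 hne z hs ht, off2_apply_other hiκ hiν]),
    cdiv_off2 hne z hs ht, cmod_off2 hne z hs ht]
  unfold cellVal
  rw [if_pos hκν, off2_apply_right hne, off2_apply_left hne, Int.toNat_natCast]
  simp only [natCast_eq_sub_one_iff hL]

/-- THE GENERIC 2-SKELETON BOND in direction `ν` («vertical» when `κ < ν`): at `L z + s e_κ + t e_ν`, `s, t < L`, its
value is `[h^{sL} · T(z, ν) if t = L − 1]`, else `1`. [folklore] -/
theorem val_vertical (hW : LawfulFill L T h W) {κ ν : Fin d} (hκν : κ < ν) (z : Site d) {s t : ℕ}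
    (hs : s < L) (ht : t < L) :
    W ((L : ℤ) • z + off2 κ ν s t) ν
      = (if t = L - 1 then (h z κ ν) ^ (s * L) * T z ν else 1) := by
  have hL : 1 ≤ L := by omega
  have hne : κ ≠ ν := ne_of_lt hκν
  rw [hW _ ν κ (fun i hiν hiκ => by rw [cmod_off2 hne z hs ht, off2_apply_other hiκ hiν]),
    cdiv_off2 hne z hs ht, cmod_off2 hne z hs ht]
  unfold cellVal
  rw [if_neg (lt_asymm hκν), if_pos hκν, off2_apply_right hne, off2_apply_left hne, Int.toNat_natCast]
  simp only [natCast_eq_sub_one_iff hL]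

end Bonds


/-! ## §3 The chain products: `W(Γ_c) = T(c)` -/

section Chains

variable {G : Type*} [Group G] {L : ℕ} {T : Site d → Fin d → G} {h : Site d → Fin d → Fin d → G}
  {W : Site d → Fin d → G}

/-- The bonds ON a coarse line: the `m`-th fine bond of the coarse bond `(z, κ)` is `1` for `m < L − 1` and `T(z, κ)` for
`m = L − 1` — the chain `(1, …, 1, T)` of the 1-skeleton. [folklore] -/
theorem val_line (hW : LawfulFill L T h W) (z : Site d) (κ : Fin d) {m : ℕ} (hm : m < L) :
    W ((L : ℤ) • z + (m : ℤ) • e κ) κ = if m = L - 1 then T z κ else 1 := by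
  have hL : 1 ≤ L := by omega
  have hq0 : ∀ i, 0 ≤ ((m : ℤ) • e κ) i := fun i => by
    simp only [Pi.smul_apply, e_apply, smul_eq_mul]; split_ifs <;> positivity
  have hqL : ∀ i, ((m : ℤ) • e κ) i < L := fun i => by
    simp only [Pi.smul_apply, e_apply, smul_eq_mul]
    split_ifs
    · simpa using (by exact_mod_cast hm : (m : ℤ) < L)
    · simpa using (by exact_mod_cast hL : (0 : ℤ) < L)
  have hc := cdiv_eq_of_repr (L := L) (x := (L : ℤ) • z + (m : ℤ) • e κ) rfl hq0 hqL
  have hq := cmod_eq_of_repr (L := L) (x := (L : ℤ) • z + (m : ℤ) • e κ) rfl hq0 hqL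
  rw [hW _ κ κ (fun i hi _ => by rw [hq]; simp [e_apply, hi]), hc, hq,
    cellVal_of_line T h (fun hκκ => absurd rfl hκκ)]
  simp only [Pi.smul_apply, e_apply, if_true, smul_eq_mul, mul_one, natCast_eq_sub_one_iff hL]

/-- Partial chain products are trivial before the last bond. [folklore] -/
theorem hol_seg_of_lt (hW : LawfulFill L T h W) (z : Site d) (κ : Fin d) {m : ℕ} (hm : m < L) :
    hol W ((L : ℤ) • z) (seg κ m) = 1 := by
  induction m with
  | zero => simp
  | succ m ih =>
    rw [show ((m + 1 : ℕ) : ℤ) = (m : ℤ) + 1 by push_cast; ring, hol_seg_succ, ih (by omega),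
      val_line hW z κ (by omega : m < L), if_neg (by omega), mul_one]

/-- **THE CHAIN PRODUCT OF THE 1-SKELETON**: along the coarse bond `c = (z, κ)` a lawful configuration has holonomy
`W(Γ_c) = T(z, κ)` — so the averaged bond `\bar W(c) = exp(X_c(W)) · T(z, κ)` of (42) is steered by the datum `T`.
[folklore] -/
theorem hol_seg_eq (hW : LawfulFill L T h W) (hL : 1 ≤ L) (z : Site d) (κ : Fin d) :
    hol W ((L : ℤ) • z) (seg κ L) = T z κ := by
  obtain ⟨m, rfl⟩ : ∃ m, L = m + 1 := ⟨L - 1, by omega⟩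
  rw [show ((m + 1 : ℕ) : ℤ) = (m : ℤ) + 1 by push_cast; ring, hol_seg_succ,
    show ((m : ℤ) + 1) • z = ((m + 1 : ℕ) : ℤ) • z by push_cast; rfl,
    hol_seg_of_lt hW z κ (by omega : m < m + 1), one_mul, val_line hW z κ (by omega : m < m + 1),
    if_pos (by omega)]

end Chains

/-! ## §4 Every fine plaquette of a coarse 2-cell equals the root `h` -/

section Plaquettes

variable {G : Type*} [Group G] {L : ℕ} {T : Site d → Fin d → G} {h : Site d → Fin d → Fin d → G}
  {W : Site d → Fin d → G}

/-- Power bookkeeping: `(a^t)⁻¹ · a^{t+1} = a`. [folklore] -/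
theorem pow_inv_mul_pow_succ (a : G) (t : ℕ) : (a ^ t)⁻¹ * a ^ (t + 1) = a := by
  rw [pow_succ, ← mul_assoc, inv_mul_cancel, one_mul]

/-- Power bookkeeping: `(a^{L−1})⁻¹ · a^{(s+1)L} · (a^{sL})⁻¹ = a` (`1 ≤ L`). [folklore] -/
theorem pow_top_row (a : G) (hL : 1 ≤ L) (s : ℕ) :
    (a ^ (L - 1))⁻¹ * a ^ ((s + 1) * L) * (a ^ (s * L))⁻¹ = a := by
  obtain ⟨m, rfl⟩ : ∃ m, L = m + 1 := ⟨L - 1, by omega⟩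
  rw [show m + 1 - 1 = m by omega, show (s + 1) * (m + 1) = (m + 1) + s * (m + 1) by ring, pow_add,
    mul_assoc, mul_inv_cancel_right, pow_inv_mul_pow_succ]

/-- Power bookkeeping: `(a^{L−1})⁻¹ · a^{L·L} · (a^{(L−1)L})⁻¹ = a` (`1 ≤ L`). [folklore] -/
theorem pow_corner (a : G) (hL : 1 ≤ L) :
    (a ^ (L - 1))⁻¹ * a ^ (L * L) * (a ^ ((L - 1) * L))⁻¹ = a := by
  have := pow_top_row a hL (L - 1)
  rwa [Nat.sub_add_cancel hL] at this

/-- **EVERY FINE PLAQUETTE OF THE COARSE 2-CELL `(z; κ < ν)` EQUALS `h(z; κ, ν)`** (EXACTLY, not up to conjugation):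
for a lawful configuration and root data with `h^{L²} = T(∂p)` (`T(∂p) = hol T z (plaqWord κ ν)`, the plaquette holonomy
of the 1-skeleton datum read as a configuration on the coarse lattice), the holonomy of each of the `L²` unit plaquettes
`L z + s e_κ + t e_ν` (`s, t < L`) of the cell is `h(z; κ, ν)`.  Four cases: interior; last column (the `T(z, κ)` cancel);
top row (the compensating powers `h^{sL}` telescope); the far corner (where `h^{L²} = T(∂p)` enters). [folklore] -/
theorem hol_plaq_eq (hW : LawfulFill L T h W) {κ ν : Fin d} (hκν : κ < ν) (z : Site d)
    (hroot : (h z κ ν) ^ (L * L) = hol T z (plaqWord κ ν)) {s t : ℕ} (hs : s < L) (ht : t < L) :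
    hol W ((L : ℤ) • z + off2 κ ν s t) (plaqWord κ ν) = h z κ ν := by
  have hL : 1 ≤ L := by omega
  rw [hol_plaqWord_eq, add_assoc ((L : ℤ) • z), off2_add_e_left, add_assoc ((L : ℤ) • z), off2_add_e_right,
    val_horizontal hW hκν z hs ht, val_vertical hW hκν z hs ht]
  by_cases hsL : s = L - 1
  · by_cases htL : t = L - 1
    · -- the far corner
      subst hsL; subst htL
      rw [carry_left hL, carry_right hL, val_vertical hW hκν (z + e κ) (by omega) (by omega),
        val_horizontal hW hκν (z + e ν) (by omega) (by omega)]
      simp only [if_true, zero_mul, pow_zero, one_mul, inv_one]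
      rw [hol_plaqWord_eq] at hroot
      calc (h z κ ν ^ (L - 1))⁻¹ * T z κ * T (z + e κ) ν * (T (z + e ν) κ)⁻¹
            * (h z κ ν ^ ((L - 1) * L) * T z ν)⁻¹
          = (h z κ ν ^ (L - 1))⁻¹ * (T z κ * T (z + e κ) ν * (T (z + e ν) κ)⁻¹ * (T z ν)⁻¹)
              * (h z κ ν ^ ((L - 1) * L))⁻¹ := by simp only [mul_inv_rev, mul_assoc]
        _ = h z κ ν := by rw [← hroot, pow_corner _ hL]
    · -- last column, not top row
      subst hsL
      have ht' : t + 1 < L := by omega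
      rw [carry_left hL, val_vertical hW hκν (z + e κ) (by omega) ht, val_horizontal hW hκν z hs ht']
      simp only [if_true, htL, if_false, mul_one, inv_one, zero_mul, pow_zero, one_mul]
      rw [mul_inv_rev, inv_inv, ← mul_assoc, mul_assoc _ (T z κ), mul_inv_cancel, mul_one, pow_inv_mul_pow_succ]
  · by_cases htL : t = L - 1
    · -- top row, not last column
      subst htL
      have hs' : s + 1 < L := by omega
      rw [carry_right hL, val_horizontal hW hκν (z + e ν) hs (by omega), val_vertical hW hκν z hs' ht]
      simp only [hsL, if_false, if_true, mul_one, pow_zero, inv_one]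
      rw [mul_inv_rev, ← mul_assoc, ← mul_assoc, mul_inv_cancel_right, pow_top_row _ hL]
    · -- interior
      have hs' : s + 1 < L := by omega
      have ht' : t + 1 < L := by omega
      rw [val_vertical hW hκν z hs' ht, val_horizontal hW hκν z hs ht']
      simp only [hsL, htL, if_false, mul_one, inv_one, inv_inv, pow_inv_mul_pow_succ]

/-- The same for `skelFill` itself. [folklore] -/
theorem hol_plaq_skelFill {κ ν : Fin d} (hκν : κ < ν) (z : Site d)
    (hroot : (h z κ ν) ^ (L * L) = hol T z (plaqWord κ ν)) {s t : ℕ} (hs : s < L) (ht : t < L) :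
    hol (skelFill L T h) ((L : ℤ) • z + off2 κ ν s t) (plaqWord κ ν) = h z κ ν :=
  hol_plaq_eq (lawfulFill_skelFill T h) hκν z hroot hs ht

/-- The chain products of `skelFill` itself. [folklore] -/
theorem hol_seg_skelFill (hL : 1 ≤ L) (z : Site d) (κ : Fin d) :
    hol (skelFill L T h) ((L : ℤ) • z) (seg κ L) = T z κ :=
  hol_seg_eq (lawfulFill_skelFill T h) hL z κ

end Plaquettes

/-! ## §5 Transport: values in a subgroup; periodicity -/

section Transport

variable {G : Type*} [Group G] {L : ℕ} {T : Site d → Fin d → G} {h : Site d → Fin d → Fin d → G}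

/-- `cellVal` takes values in any subgroup containing the data. [folklore] -/
theorem cellVal_mem {S : Subgroup G} (hT : ∀ z κ, T z κ ∈ S) (hh : ∀ z κ ν, h z κ ν ∈ S) (z q : Site d)
    (μ ν : Fin d) : cellVal L T h z q μ ν ∈ S := by
  unfold cellVal
  split_ifs
  · exact S.mul_mem (S.inv_mem (S.pow_mem (hh _ _ _) _)) (hT _ _)
  · exact S.mul_mem (S.inv_mem (S.pow_mem (hh _ _ _) _)) S.one_mem
  · exact S.mul_mem (S.pow_mem (hh _ _ _) _) (hT _ _)
  · exact S.one_mem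
  · exact hT _ _
  · exact S.one_mem

/-- **The 2-skeleton filling takes values in any subgroup containing the data** (e.g. the unitary group). [folklore] -/
theorem skelFill_mem {S : Subgroup G} (hT : ∀ z κ, T z κ ∈ S) (hh : ∀ z κ ν, h z κ ν ∈ S) (x : Site d)
    (μ : Fin d) : skelFill L T h x μ ∈ S := by
  unfold skelFill
  split_ifs
  · exact cellVal_mem hT hh _ _ _ _
  · exact S.one_mem
  · exact hT _ _
  · exact S.one_mem

/-- **PERIODICITY**: if the data `T`, `h` are `P`-periodic on the coarse lattice, the 2-skeleton filling is
`L·P`-periodic on the fine lattice (a configuration on the refined torus). [folklore] -/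
theorem skelFill_add_period (hL : 1 ≤ L) {P : ℤ} (hT : ∀ z κ μ, T (z + P • e κ) μ = T z μ)
    (hh : ∀ z κ μ ν, h (z + P • e κ) μ ν = h z μ ν) (x : Site d) (κ μ : Fin d) :
    skelFill L T h (x + ((L : ℤ) * P) • e κ) μ = skelFill L T h x μ := by
  unfold skelFill
  simp only [tset_add_period, cdiv_add_period hL, cmod_add_period, hT]
  congr 1
  · funext hne
    unfold cellVal
    simp only [hT, hh]

end Transport

end Summit.QuantumFields.BalabanUV.T4Continuum.SkeletonFill
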